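import Mathlib

/-!
# The algebraic relation between the Hauptmodul of `Γ₀(4)+` and the `j`-invariant (level-4 uniformisation; Weber's `𝔣²⁴`)

Context (classical; Cox, *Primes of the form x² + ny²* (2022) §12.B: the Weber functions (12.14)–(12.16),
`𝔣(τ)𝔣₁(τ)𝔣₂(τ) = √2`, `𝔣₁(2τ)𝔣₂(τ) = √2`, the differences (12.18) `e₂−e₁ = π²η⁴𝔣⁸`, `e₂−e₃ = π²η⁴𝔣₁⁸`,
`e₃−e₁ = π²η⁴𝔣₂⁸` (so `𝔣⁸ = 𝔣₁⁸ + 𝔣₂⁸`), and Theorem 12.17: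
`γ₂(τ) = (𝔣(τ)²⁴ − 16)/𝔣(τ)⁸ = (𝔣₁(τ)²⁴ + 16)/𝔣₁(τ)⁸ = (𝔣₂(τ)²⁴ + 16)/𝔣₂(τ)⁸`, `j = γ₂³` [Cox2022];
Lian–Yau, CMP 176 (1996) §6, table of K3 pencils: the complete intersection `X_(2,2,2) ⊂ ℙ⁵` has mirror map
`1/z = q⁻¹ + 24 + 276q + 2048q² + …`, a Hauptmodul for `Γ₀(4)+` [LianYau1996]).  By (12.14)–(12.16),
`𝔣(2τ) = √2/(𝔣₁(2τ)𝔣₂(2τ)) = η(2τ)²/(η(τ)η(4τ)) = q^{-1/24} ∏ (1 + q^{2n−1})`, so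
`X(τ) := 𝔣(2τ)²⁴ = η(2τ)⁴⁸/(η(τ)η(4τ))²⁴ = q⁻¹ + 24 + 276q + 2048q² + …` is that Hauptmodul, and Theorem 12.17 at `τ' = 2τ`
says `X · j(2τ) = (X − 16)³`.

This file is PURELY ALGEBRAIC: it records the relation `P X J = X·J − (X − 16)³` — LINEAR in `J`
(`j(2τ) = (X−16)³/X` is a rational function of degree `3 = [PSL₂(ℤ) : Γ₀(4)+]` on the `X`-line), the three Weber branches
`X ∈ {𝔣(τ')²⁴, −𝔣₁(τ')²⁴, −𝔣₂(τ')²⁴}` over `J = j(τ')` (each from one of the three printed formulas for `γ₂`, and all three at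
once from `𝔣⁸ = 𝔣₁⁸ + 𝔣₂⁸`, `(𝔣𝔣₁𝔣₂)⁸ = 16`), the Legendre form `X = 16/(λ(1−λ))`, `J = 2⁸(λ²−λ+1)³/(λ²(λ−1)²)`
(`λ = 𝔣₂⁸/𝔣⁸`; Silverman AEC III.1.7(b) [SilvermanAEC2009]), and the rational CM fibres over the class-number-one
`j`-values of Cox's table (12.20): `j(i) = 1728 ↦ X ∈ {64, −8, −8}`, `j(√−2) = 8000 ↦ X = −64`, `j(√−3) = 54000 ↦ X = 256`,
`j(2i) = 66³ ↦ X = −512`, `j(√−7) = 255³ ↦ X = 4096`, `j((1+√−7)/2) = −3375 ↦ X = 1`, `j(ρ) = 0 ↦ X = 16` (triple).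
No analytic statement about `η`, `𝔣` or `j` is asserted.  Used by the pub-hlocus absolute-Hodge tables (CM fibres of the
`X_(2,2,2)` K3 pencil: `N_D(X) = Res_J(P(X,J), H_D(J)) = X^{h(D)} H_D((X−16)³/X)`, degree `3h(D)`).
-/

namespace Literature.NumberTheory.ModularForms.HauptmodulLevelFourPlus

/-- The level-4 relation between `X = 𝔣(τ')²⁴` (`τ' = 2τ`; `X = η(2τ)⁴⁸/(η(τ)η(4τ))²⁴ = q⁻¹ + 24 + …`, Hauptmodul of `Γ₀(4)+`)
and `J = j(τ')`: `X·J − (X−16)³` (Weber: `j = (𝔣²⁴ − 16)³/𝔣²⁴`). [cite: Cox2022, §12.B Theorem 12.17 (γ₂ in terms of the Weber functions)] [cite: LianYau1996, §6 table (X_(2,2,2) ⊂ ℙ⁵: 1/z = q⁻¹ + 24 + 276q + …, Γ₀(4)+)] -/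
def P {S : Type*} [CommRing S] (X J : S) : S :=
  X * J - (X - 16) ^ 3

/-- `P` is linear in `J`: over a field, for `X ≠ 0`, `P X J = 0 ↔ J = (X − 16)³/X` (`j(2τ)` is a rational function of the
Hauptmodul). [cite: Cox2022, §12.B Theorem 12.17 (γ₂ in terms of the Weber functions)] -/
theorem P_eq_zero_iff {F : Type*} [Field F] (X J : F) (hX : X ≠ 0) :
    P X J = 0 ↔ J = (X - 16) ^ 3 / X := by
  rw [eq_div_iff hX]
  unfold P
  constructor
  · intro h
    linear_combination h
  · intro h
    linear_combination h

/-- Branch `X = 𝔣(τ')²⁴`: with `a = 𝔣(τ')⁸ ≠ 0`, `γ₂ = (a³ − 16)/a` (Cox Thm 12.17, first formula) and `j = γ₂³`: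
`P (a³) (((a³−16)/a)³) = 0`. [cite: Cox2022, §12.B Theorem 12.17 (γ₂ in terms of the Weber functions)] -/
theorem P_eq_zero_weber_f {F : Type*} [Field F] (a : F) (ha : a ≠ 0) :
    P (a ^ 3) (((a ^ 3 - 16) / a) ^ 3) = 0 := by
  unfold P
  field_simp
  ring

/-- Branches `X = −𝔣₁(τ')²⁴` and `X = −𝔣₂(τ')²⁴`: with `g = 𝔣₁(τ')⁸` (resp. `𝔣₂(τ')⁸`) `≠ 0`, `γ₂ = (g³ + 16)/g`
(Cox Thm 12.17, second and third formulas): `P (−g³) (((g³+16)/g)³) = 0`. [cite: Cox2022, §12.B Theorem 12.17 (γ₂ in terms of the Weber functions)] -/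
theorem P_eq_zero_weber_f1_f2 {F : Type*} [Field F] (g : F) (hg : g ≠ 0) :
    P (-(g ^ 3)) (((g ^ 3 + 16) / g) ^ 3) = 0 := by
  unfold P
  field_simp
  ring

/-- All three branches at once.  With `b = 𝔣₁(τ')⁸`, `c = 𝔣₂(τ')⁸`: (12.18) gives `𝔣⁸ = 𝔣₁⁸ + 𝔣₂⁸ = b + c` and (12.16)
gives `(𝔣𝔣₁𝔣₂)⁸ = 16`, i.e. `b·c·(b+c) = 16`; then over `J = γ₂³ = (((b+c)³ − 16)/(b+c))³` the cubic `X ↦ P X J` factors as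
`−(X − (b+c)³)(X + b³)(X + c³)`: its three roots are `𝔣²⁴, −𝔣₁²⁴, −𝔣₂²⁴` (sum `48`, product `4096`). [cite: Cox2022, §12.B (12.16), (12.18) and Theorem 12.17] -/
theorem weber_three_branches {F : Type*} [Field F] (b c X : F) (hs : b + c ≠ 0) (h : b * c * (b + c) = 16) :
    P X ((((b + c) ^ 3 - 16) / (b + c)) ^ 3) = -((X - (b + c) ^ 3) * (X + b ^ 3) * (X + c ^ 3)) := by
  unfold P
  rw [show (16 : F) = b * c * (b + c) from h.symm]
  field_simp
  ring

/-- Weber's identities in the form used by the tables: `𝔣²⁴ − 𝔣₁²⁴ − 𝔣₂²⁴ = 48` and `𝔣²⁴𝔣₁²⁴𝔣₂²⁴ = 4096`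
(from `𝔣⁸ = 𝔣₁⁸ + 𝔣₂⁸`, `(𝔣𝔣₁𝔣₂)⁸ = 16`). [cite: Cox2022, §12.B (12.16), (12.18)] -/
theorem weber_power_sums {S : Type*} [CommRing S] (b c : S) (h : b * c * (b + c) = 16) :
    (b + c) ^ 3 - b ^ 3 - c ^ 3 = 48 ∧ (b + c) ^ 3 * b ^ 3 * c ^ 3 = 4096 := by
  constructor
  · linear_combination (3 : S) * h
  · linear_combination (b ^ 2 * c ^ 2 * (b + c) ^ 2 + 16 * b * c * (b + c) + 256) * h

/-- Legendre form (`λ = 𝔣₂⁸/𝔣⁸`, `1 − λ = 𝔣₁⁸/𝔣⁸`): `X = 16/(λ(1−λ))` and `J = 2⁸(λ²−λ+1)³/(λ²(λ−1)²)` (the `j`-invariant of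
`y² = x(x−1)(x−λ)`, Silverman AEC III.1.7(b)) satisfy `P X J = 0`. [cite: SilvermanAEC2009, III.1.7(b) (j-invariant of the Legendre form)] [cite: Cox2022, §12.B Theorem 12.17 (γ₂ in terms of the Weber functions)] -/
theorem P_eq_zero_legendre {F : Type*} [Field F] (l : F) (h0 : l ≠ 0) (h1 : l ≠ 1) :
    P (16 / (l * (1 - l))) (256 * (l ^ 2 - l + 1) ^ 3 / (l ^ 2 * (l - 1) ^ 2)) = 0 := by
  have h1' : (1 - l) ≠ 0 := sub_ne_zero.mpr (Ne.symm h1)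
  have h1'' : (l - 1) ≠ 0 := sub_ne_zero.mpr h1
  unfold P
  field_simp
  ring

/-! ## Rational CM fibres over the class-number-one `j`-values (Cox (12.20)) -/

/-- `D = −3`, `j(ρ) = 0`: `P X 0 = −(X − 16)³` (the covering `X ↦ J` is totally ramified over `j = 0`: the three Weber values
`𝔣(ρ)²⁴ = 16`, `−𝔣₁(ρ)²⁴ = 16`, `−𝔣₂(ρ)²⁴ = 16` coincide). [cite: Cox2022, §12.C table (12.20) (j-invariants of class number one)] -/
theorem fibre_D3 {S : Type*} [CommRing S] (X : S) : P X 0 = -((X - 16) ^ 3) := by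
  unfold P; ring

/-- `D = −4`, `j(i) = 1728`: `P X 1728 = −(X − 64)(X + 8)²` — `X = 64 = 𝔣(i)²⁴` is the conifold fibre (`τ = i/2 = Fix W₄`),
`X = −8 = −𝔣₁(i)²⁴ = −𝔣₂(i)²⁴` a double root. [cite: Cox2022, §12.C table (12.20) (j-invariants of class number one)] -/
theorem fibre_D4 {S : Type*} [CommRing S] (X : S) : P X 1728 = -((X - 64) * (X + 8) ^ 2) := by
  unfold P; ring

/-- `D = −7`, `j((1+√−7)/2) = −3375 = −15³`: `P X (−3375) = −(X − 1)(X² − 47X + 4096)`. [cite: Cox2022, §12.C table (12.20) (j-invariants of class number one)] -/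
theorem fibre_D7 {S : Type*} [CommRing S] (X : S) : P X (-3375) = -((X - 1) * (X ^ 2 - 47 * X + 4096)) := by
  unfold P; ring

/-- `D = −8`, `j(√−2) = 8000 = 20³`: `P X 8000 = −(X + 64)(X² − 112X − 64)` (`𝔣(√−2)²⁴ = 56 + 40√2`). [cite: Cox2022, §12.C table (12.20) (j-invariants of class number one)] -/
theorem fibre_D8 {S : Type*} [CommRing S] (X : S) : P X 8000 = -((X + 64) * (X ^ 2 - 112 * X - 64)) := by
  unfold P; ring

/-- `D = −12`, `j(√−3) = 54000`: `P X 54000 = −(X − 256)(X² + 208X + 16)` (`𝔣(√−3)²⁴ = 256`). [cite: Cox2022, §12.C table (12.20) (j-invariants of class number one)] -/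
theorem fibre_D12 {S : Type*} [CommRing S] (X : S) : P X 54000 = -((X - 256) * (X ^ 2 + 208 * X + 16)) := by
  unfold P; ring

/-- `D = −16`, `j(2i) = 287496 = 66³`: `P X 287496 = −(X + 512)(X² − 560X − 8)` (`𝔣₁(2i)²⁴ = 512`). [cite: Cox2022, §12.C table (12.20) (j-invariants of class number one)] -/
theorem fibre_D16 {S : Type*} [CommRing S] (X : S) : P X 287496 = -((X + 512) * (X ^ 2 - 560 * X - 8)) := by
  unfold P; ring

/-- `D = −28`, `j(√−7) = 16581375 = 255³`: `P X 16581375 = −(X − 4096)(X² + 4048X + 1)` (`𝔣(√−7)²⁴ = 4096`). [cite: Cox2022, §12.C table (12.20) (j-invariants of class number one)] -/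
theorem fibre_D28 {S : Type*} [CommRing S] (X : S) : P X 16581375 = -((X - 4096) * (X ^ 2 + 4048 * X + 1)) := by
  unfold P; ring

/-- The remaining class-number-one values give cubics with no rational root (`2` inert): e.g. `D = −11`, `j = −32768 = −32³`:
`P X (−32768) = −(X³ − 48X² + 33536X − 4096)`. [cite: Cox2022, §12.C table (12.20) (j-invariants of class number one)] -/
theorem fibre_D11 {S : Type*} [CommRing S] (X : S) : P X (-32768) = -(X ^ 3 - 48 * X ^ 2 + 33536 * X - 4096) := by
  unfold P; ring

end Literature.NumberTheory.ModularForms.HauptmodulLevelFourPlus
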